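import Literature.MathematicalPhysics.QuantumFieldTheory.Balaban1983to89.B8LeafKnitZd3E
import Literature.MathematicalPhysics.QuantumFieldTheory.Balaban1983to89.B8Thm4TorusAt

/-!
# `Balaban1983to89.B8Thm2TorusMember` — [Balaban1985RegularSpaces] THEOREM 2 (p. 83) FOR THE DOMAIN SEQUENCE `Ω_j = T_η`
# (p. 77, the admitted case «Ω_j = T_η for j = 0,1,…,l, l ≤ k» with `l = k`) AS A MEMBER OF THE GENERAL-BACKGROUND `ℤᵈ × 𝔸`
# FAMILY `zdGF3`: the torus members `torusIdx` of `B8LeafModelZd.ZdIdx` (every `Ω_j = ℤᵈ`, constraint sequence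
# `B8Thm4TorusAt.torusLam` at every truncation, constraint bonds = all bonds of the top lattice) and THEOREM 2 AT THESE MEMBERS
# modulo the four sockets of the knit AT THE TORUS MEMBERS ONLY (sub-row «G-B8-T2S», module M2 of `lit-balaban-p33/T2S-MAP.md`)

statement-level skeleton of published theorems with citation tags; proofs where landed; nothing here is a claim about the
Yang–Mills mass gap

T. Bałaban, *Spaces of regular gauge field configurations on a lattice and gauge fixing conditions*, Commun. Math. Phys. **99**
(1985) 75–102 `[Balaban1985RegularSpaces]` ("B8"; printed page = PDF page + 74): Theorem 2 p. 83, (1.33)–(1.39) pp. 82–83, (1.29) p. 81,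
(1.3)–(1.6) p. 77 («Let us notice that we admit the case where some domains Ω_j are equal to T_η, for example Ω_j = T_η for j = 0,1,…,l,
l ≤ k»), Theorem 4 p. 88 («Of course this theorem implies Theorem 2»).  STATUS: published, refereed.

CITATION HEADER (lean-in-tree rule).  Cell `lit-balaban`, seat `lit-balaban-p33` (gen 90), sub-row «G-B8-T2S» = the [B8] §3 THEOREM 2 TORUS
SUPPLIER for R3 `stmt-QuantumFields-19200` (ym3 ★★OWNER WANTED W-19200-T2; lead g29 2026-08-27T23:59Z), module **M2** of the module map
`lit-balaban-p33/T2S-MAP.md`.  WHAT IS REPRODUCED: the interface of record `B8Thm2TorusAt.Thm2TorusAt` has CONSUMERS only; the landed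
`ℤᵈ` knit proves Theorem 2 for INDEX-MAPPED SUB-FAMILIES of `zdGF3` whose members have `Ω₀ = ℤᵈ`, modulo the knit's sockets on the image
(`B8LeafKnitZd3E.thm2_of135_zd3_map_b9allE`).  This file supplies THE INDEX MAP OF THE TORUS: the members `torusIdx hL t`, `t : TorusMember`
(`η > 0`, `k ≥ 1`; `Ω_j := ℤᵈ` for every `j`; `Λs m := torusLam m` — no constraint below the top level `m`, every site of the top lattice a
constraint site, (1.28) p. 81 with `Ω_m = T_η`; `Λb m j :=` all bonds of the `m`-lattice for `j = m`, none below), proves the structure laws of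
`ZdIdx` for them (`hbox`, `hclass` = every constraint bond INTERIOR, `htower`, the partition clause `hpart` = every site lies in the tower of
its level-`k` ancestor block) and the geometric premise of the knit's Theorem 2 (every level-`ℓ` block has a level-`k` ancestor in `Λ_k`),
and states **THEOREM 2 AT THE TORUS MEMBERS** `thm2_torus_of_socketsE` = `thm2_of135_zd3_map_b9allE` at `ι := torusIdx hL` with that premise
discharged: ONE triple `B₁, B₂(β), c₁ > 0` for ALL torus members, modulo — per torus member — Proposition 5's fixed points `SockHFP₀`∕`SockHFP`,
its repaired uniqueness socket `SockP5uE`, and the Prop.-3-frame in-edge b9 `SockB9P3` ([4] Thm 3.3) at every truncation.  The degenerate-member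
hazard of the (1.59) socket at `Ω₀ = ℤᵈ` (`B8SockH59NotAtUnivDegenerate`: FALSE when the constraint data are EMPTY) does not arise: the
torus member's level-`k` constraint data are ALL level-`k` bonds (`torusLam k k = univ`).  Kind: definitions with bodies (`TorusMember`,
`torusLamb`, `torusIdx`) + kernel-checked theorems; no `… : Prop` fact; no existing module modified.

## WHAT IS CERTIFIED HERE (kernel; axioms `propext` ∕ `Classical.choice` ∕ `Quot.sound`)
* §1 `exists_under` (every site of the `n`-times finer lattice lies under a site: `∃ y, Under L n y w`), `inBox_tower_of_under`;
* §2 `TorusMember`, `torusLamb` (`mem_torusLamb_iff`), **`torusIdx`** (the torus members of `ZdIdx d L`), `torusIdx_geom` (the knit's Theorem-2 premise at them),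
  `bondTouches_torusLam_iff` (the (1.35) bonds of the torus member are exactly the bonds of the top lattice);
* §3 **`thm2_torus_of_socketsE`** — THEOREM 2 AT EVERY TORUS MEMBER modulo the four sockets at torus members; **`thm2_torus_of_socketsE_cond135T`** —
  the same with (1.35) in the form of record `B8Thm2TorusAt.Cond135T` (strict, top level only).

## HONEST SCOPE — what is NOT claimed
(i) Nothing of Propositions 3∕5, Theorem 4, (1.42), (1.59), (1.65) is re-proved (the knit, by name).  (ii) The four sockets remain hypotheses AT
THE TORUS MEMBERS; at a general regular background `U₀` they bottom out at [4] = [Balaban1985BackgroundPropagators] Thms 3.1–3.3 for that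
background, which the tree has at letters ∕ at `U = 1` only (`T2S-MAP.md` (a), M5…).  (iii) NOT YET `Thm2TorusAt`: the data here are
`P`-periodic-or-not functions on `ℤᵈ`; the PERIODICITY of the produced gauge transformation (joint (b) of the map, module M1) and the
`SU(N)`-closure (joint J-SU) are separate modules; the conclusion is in `zdGF3`'s currency (`SideTouches`-guarded `≤` bounds at smallness
`α₀ + (11d²α₀ + α₁)`), the translation to `C136T`∕`C139T` is module M4.  (iv) `d ≥ 2`, `L ≥ 2`, `𝔸` a C⋆-algebra; `T_η ↦ ℤᵈ` read
periodically by the consumer.  Count-neutral; N05 not discharged; nothing continuum ∕ ℝ⁴ ∕ OS ∕ mass-gap ∕ Clay.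
-/

noncomputable section

open NormedSpace

namespace Literature.MathematicalPhysics.QuantumFieldTheory.Balaban1983to89.B8Thm2TorusMember

open B7Prop1Explicit B7Prop2Explicit B7Prop1Local B7Eq92Concrete
open B8Ineq132 (InAk BondTouches Under)
open B8Lemma1NonAbelian (mulCfg)
open B8Ineq130 (tlo thi tlo_apply thi_apply fl)
open B8Thm4TorusAt (torusLam mem_torusLam_iff torusLam_of_ne)
open B8LeafModelZd (ZdIdx)
open B8LeafModelZdSockP5uE (SockP5uE)
open B8LeafModelZdOfHFP (SockHFP₀ SockHFP)
open B8LeafModelZd3 (zdGF3 SockB9P3)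
open B8LeafKnitZd3E (thm2_of135_zd3_map_b9allE)
open B8Eq131Derivation (under_zero_iff under_one_block under_succ_of_under_block)
open B8Eq115GaugeFixing (exists_block)

-- `Site` alone could resolve to the torus sites of `Setup.lean`; re-export the `ℤ^d` sites of `B7Prop1Explicit`.
export B7Prop1Explicit (Site)

variable {d : ℕ}

/-! ## §1  Ancestor blocks -/

/-- **Every site lies under some site of the `n`-times coarser lattice** (`Bⁿ(y) ∋ w` for the iterated block ancestor `y` of `w`; the
block decomposition `ℤᵈ = ⋃_y B(y)` iterated). [cite: Balaban1985RegularSpaces, p.79 («x₀ ∈ Bʲ(x_j)»), (1.5)–(1.6) p.77] -/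
theorem exists_under {L : ℕ} (hL : 1 ≤ L) : ∀ (n : ℕ) (w : Site d), ∃ y : Site d, Under L n y w
  | 0, w => ⟨w, (under_zero_iff L w w).2 rfl⟩
  | n + 1, w => by
      obtain ⟨x, hx⟩ := exists_under hL n w
      obtain ⟨r, hr⟩ := exists_block hL x
      refine ⟨fl L x, ?_⟩
      have h1 : Under L 1 (fl L x) x := by
        have h := under_one_block L (fl L x) r
        rwa [← hr] at h
      exact under_succ_of_under_block h1 hx

/-- **`Bⁿ(y)` is the depth-`n` tower cube of `y`**: `Under L n y w` puts `w` in the box `[tlo L y n, thi L y n]` (`B8Ineq132.under_tower` at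
depth `0`). [cite: Balaban1985RegularSpaces, p.98 («□_j is a sum of the big blocks»), (1.5) p.77] -/
theorem inBox_tower_of_under {L n : ℕ} {y w : Site d} (h : Under L n y w) : InBox (tlo L y n) (thi L y n) w := by
  have h' := B8Ineq132.under_tower (L := L) (lo := y) (hi := y) (m₀ := 0) (x := y) (le_of_eq (by simp)) (le_of_eq (by simp)) h
  rw [zero_add] at h'
  exact fun i => ⟨h'.1 i, h'.2 i⟩

/-! ## §2  The torus members of `ZdIdx` -/

/-- **Index of a torus member**: lattice spacing `η > 0` and the number `k ≥ 1` of averaging levels (the torus side `P` enters only through the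
periodicity of the data, read by the consumer). [cite: Balaban1985RegularSpaces, p.77 («Ω_j = T_η for j = 0,1,…,l»), Thm 2 p.83] -/
structure TorusMember where
  /-- lattice spacing -/
  η : ℝ
  hη : 0 < η
  /-- number of averaging levels -/
  k : ℕ
  hk : 1 ≤ k

/-- **The constraint bonds of the torus member at truncation `m`**: every bond of the top lattice `j = m`, none below (the (1.42)∕(1.37) bonds
«Q_j(U₀, ηA) = B on Λ_j» with `Λ_j = ∅`, `j < m`, `Λ_m = T^{(m)}`). [cite: Balaban1985RegularSpaces, (1.37) p.82, (1.28) p.81] -/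
def torusLamb (m : ℕ) : ℕ → Set (Site d × Fin d) := fun j => if j = m then Set.univ else ∅

/-- Membership in `torusLamb`: a bond is a constraint bond of the truncation `m` iff it is a bond of the top lattice `j = m`. [cite: Balaban1985RegularSpaces, (1.37) p.82, (1.28) p.81] -/
theorem mem_torusLamb_iff (m j : ℕ) (c : Site d × Fin d) : c ∈ torusLamb (d := d) m j ↔ j = m := by
  unfold torusLamb; split_ifs with h <;> simp [h]

/-- **THE TORUS MEMBER OF `ZdIdx d L`**: `Ω_j := ℤᵈ` for every `j` (the torus `T_η` read on `ℤᵈ`), constraint sites `Λs m := torusLam m`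
(no constraint below the top level of the truncation, every top-level site a constraint site), constraint bonds `Λb m := torusLamb m`;
the structure laws: `hbox`∕`htower` trivial (`Ω_j = ℤᵈ`), `hclass` = every constraint bond is INTERIOR (both ends in `Λ_m = T^{(m)}`),
`hpart` = every site lies in the tower of its level-`k` ancestor (`exists_under`). [cite: Balaban1985RegularSpaces, p.77 (admitted case Ω_j = T_η), (1.28)–(1.29) p.81, (1.3)–(1.6) p.77] -/
def torusIdx {L : ℕ} (hL : 1 ≤ L) (t : TorusMember) : ZdIdx d L where
  η := t.η
  hη := t.hη
  k := t.k
  hk := t.hk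
  Ω := fun _ => Set.univ
  hΩ := fun _ => subset_rfl
  Λs := fun m => torusLam m
  Λb := fun m => torusLamb m
  hbox := fun _ _ _ _ _ _ _ _ => Set.mem_univ _
  hclass := by
    intro m _ j _ c hc
    have hj : j = m := (mem_torusLamb_iff m j c).1 hc
    subst hj
    exact Or.inl ⟨(mem_torusLam_iff j j c.1).2 rfl, (mem_torusLam_iff j j (c.1 + e c.2)).2 rfl⟩
  htower := fun _ _ _ _ _ _ => Set.mem_univ _
  hpart := by
    intro x _
    obtain ⟨y, hy⟩ := exists_under hL t.k x
    exact ⟨t.k, le_rfl, y, (mem_torusLam_iff t.k t.k y).2 rfl, inBox_tower_of_under hy⟩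

/-- **THE KNIT'S THEOREM-2 PREMISE AT THE TORUS MEMBER**: every site `w` of the `ℓ`-lattice, `ℓ ≤ k`, lies under a constraint site of the top
lattice — its level-`k` ancestor (`Λ_k = T^{(k)}`). [cite: Balaban1985RegularSpaces, (1.28) p.81, p.79 («x₀ ∈ Bʲ(x_j)»)] -/
theorem torusIdx_geom {L : ℕ} (hL : 1 ≤ L) (t : TorusMember) :
    ∀ ℓ, ℓ ≤ (torusIdx (d := d) hL t).k → ∀ w : Site d,
      (∀ x, InBox (tlo L w ℓ) (thi L w ℓ) x → x ∈ (torusIdx (d := d) hL t).Ω ℓ) →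
        ∃ j, ℓ ≤ j ∧ j ≤ (torusIdx (d := d) hL t).k ∧ ∃ y ∈ (torusIdx (d := d) hL t).Λs (torusIdx (d := d) hL t).k j,
          Under L (j - ℓ) y w := by
  intro ℓ hℓ w _
  obtain ⟨y, hy⟩ := exists_under hL (t.k - ℓ) w
  exact ⟨t.k, hℓ, le_rfl, y, (mem_torusLam_iff t.k t.k y).2 rfl, hy⟩

/-- **The (1.35) bonds of the torus member**: `BondTouches (torusLam k j) z μ` holds iff `j = k` (no constraint site below the top level,
every site at the top). [cite: Balaban1985RegularSpaces, (1.35) p.82, p.77 (bond convention)] -/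
theorem bondTouches_torusLam_iff (k j : ℕ) (z : Site d) (μ : Fin d) : BondTouches (torusLam (d := d) k j) z μ ↔ j = k := by
  unfold BondTouches
  by_cases h : j = k
  · subst h; simp [torusLam]
  · simp [torusLam_of_ne h, h]

/-! ## §3  Theorem 2 at the torus members, modulo the four sockets at torus members -/

section Thm2

variable {𝔸 : Type} [CStarAlgebra 𝔸] [Nontrivial 𝔸]

/-- **THEOREM 2 (p. 83) AT EVERY TORUS MEMBER `Ω_j = T_η`, MODULO THE KNIT'S FOUR SOCKETS AT TORUS MEMBERS ONLY.**  For `d, L ≥ 2`,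
`B₀ > 0` with `2 ≤ 5dLB₀`, `B₀′, B₀β > 0`, positive provider thresholds, any Hölder data `β, len`: ONE triple `B₁, B₂, c₁ > 0` such that at
EVERY torus member `t` (`η > 0`, `k ≥ 1`), for `α₀, α₁ > 0` with `α₀ + α₁ ≤ c₁` and data `U₀`, `U′` (unitary-valued on `ℤᵈ`) satisfying (1.33)
`U₀ ∈ 𝔄_k({T_η}, α₀)`, (1.34) `U′U₀ ∈ 𝔄_k({T_η}, α₀) ∩ Ax`, (1.35) on the bonds of the top lattice, there is EXACTLY ONE restricted
((1.29) for `torusLam k`) gauge transformation `u` with (1.36) [`C136` at `B₁, B₂`, smallness `α₀ + (11d²α₀ + α₁)`], (1.37) [`C137 α₁`],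
(1.38) [`Landau`] and (1.39) [`C139`] for `U′^{u⁻¹}` — `B8LeafKnitZd3E.thm2_of135_zd3_map_b9allE` at the index map `torusIdx hL` with its
geometric premise discharged by `torusIdx_geom`; modulo, per torus member, `SockHFP₀`∕`SockHFP` (Prop. 5's fixed points), `SockP5uE`
(Prop. 5's uniqueness, repaired currency) and `SockB9P3` at every truncation ([4] Thm 3.3 in Prop. 3's frame).
[cite: Balaban1985RegularSpaces, Thm 2 p.83, (1.33)–(1.39) pp.82–83, (1.29) p.81, p.77 («Ω_j = T_η»), Thm 4 p.88 («Of course this theorem implies Theorem 2»)] -/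
theorem thm2_torus_of_socketsE (hd2 : 2 ≤ d) {L : ℕ} (hL : 2 ≤ L) {β : ℝ} {len : Site d → ℝ}
    {B₀ B₀' B₀β cu cF₀ cF cu' cB9 : ℝ} (hB₀ : 0 < B₀) (hB₀' : 0 < B₀') (hB₀β : 0 < B₀β) (hB : 2 ≤ 5 * (d : ℝ) * L * B₀)
    (hcu : 0 < cu) (hcF₀ : 0 < cF₀) (hcF : 0 < cF) (hcu' : 0 < cu') (hcB9 : 0 < cB9)
    (SHFP₀ : ∀ t : TorusMember, SockHFP₀ (𝔸 := 𝔸) L B₀ B₀' cF₀ (torusIdx (d := d) (le_trans one_le_two hL) t).η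
      (torusIdx (d := d) (le_trans one_le_two hL) t).k (torusIdx (d := d) (le_trans one_le_two hL) t).Ω
      (torusIdx (d := d) (le_trans one_le_two hL) t).Λs)
    (SHFP : ∀ t : TorusMember, SockHFP (𝔸 := 𝔸) L B₀ B₀' cF (torusIdx (d := d) (le_trans one_le_two hL) t).η
      (torusIdx (d := d) (le_trans one_le_two hL) t).k (torusIdx (d := d) (le_trans one_le_two hL) t).Ω
      (torusIdx (d := d) (le_trans one_le_two hL) t).Λs)
    (SP5u : ∀ t : TorusMember, SockP5uE (𝔸 := 𝔸) L B₀ cu' cu (torusIdx (d := d) (le_trans one_le_two hL) t).η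
      (torusIdx (d := d) (le_trans one_le_two hL) t).k (torusIdx (d := d) (le_trans one_le_two hL) t).Ω
      (torusIdx (d := d) (le_trans one_le_two hL) t).Λs)
    (SB9all : ∀ t : TorusMember, ∀ m, m ≤ (torusIdx (d := d) (le_trans one_le_two hL) t).k →
      SockB9P3 (𝔸 := 𝔸) L B₀ B₀β cB9 β len (torusIdx (d := d) (le_trans one_le_two hL) t).η m
        (torusIdx (d := d) (le_trans one_le_two hL) t).Ω (torusIdx (d := d) (le_trans one_le_two hL) t).Λs
        (torusIdx (d := d) (le_trans one_le_two hL) t).Λb) :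
    ∃ B₁ B₂ c₁ : ℝ, 0 < B₁ ∧ 0 < B₂ ∧ 0 < c₁ ∧
      ∀ t : TorusMember,
        ∀ α₀ α₁ : ℝ, 0 < α₀ → 0 < α₁ → α₀ + α₁ ≤ c₁ →
          ∀ (U₀ : (zdGF3 𝔸 L β len (torusIdx (d := d) (le_trans one_le_two hL) t)).Cfg)
            (P : (zdGF3 𝔸 L β len (torusIdx (d := d) (le_trans one_le_two hL) t)).Pert),
            (zdGF3 𝔸 L β len (torusIdx (d := d) (le_trans one_le_two hL) t)).InA α₀ U₀ →
            (zdGF3 𝔸 L β len (torusIdx (d := d) (le_trans one_le_two hL) t)).Reg335 α₀ U₀ →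
            (zdGF3 𝔸 L β len (torusIdx (d := d) (le_trans one_le_two hL) t)).InAAx α₀ U₀ P →
            (∀ j, j ≤ t.k → ∀ (z : Site d) (μ : Fin d), BondTouches (torusLam (d := d) t.k j) z μ →
              (∀ x, InBox (loK L j z) (bondHiK L j z μ) x → x ∈ (Set.univ : Set (Site d))) →
              ‖(avgIter L (mulCfg P.2.1 U₀.1) j z μ : 𝔸) - (avgIter L U₀.1 j z μ : 𝔸)‖ ≤ α₁) →
            ∃ u : (zdGF3 𝔸 L β len (torusIdx (d := d) (le_trans one_le_two hL) t)).GT,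
              (zdGF3 𝔸 L β len (torusIdx (d := d) (le_trans one_le_two hL) t)).Restricted U₀ u ∧
              ((zdGF3 𝔸 L β len (torusIdx (d := d) (le_trans one_le_two hL) t)).C136 B₁ B₂ (α₀ + (11 * (d : ℝ) ^ 2 * α₀ + α₁)) U₀
                  ((zdGF3 𝔸 L β len (torusIdx (d := d) (le_trans one_le_two hL) t)).act P u) ∧
                (zdGF3 𝔸 L β len (torusIdx (d := d) (le_trans one_le_two hL) t)).C137 α₁ U₀
                  ((zdGF3 𝔸 L β len (torusIdx (d := d) (le_trans one_le_two hL) t)).act P u) ∧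
                (zdGF3 𝔸 L β len (torusIdx (d := d) (le_trans one_le_two hL) t)).Landau U₀
                  ((zdGF3 𝔸 L β len (torusIdx (d := d) (le_trans one_le_two hL) t)).act P u) ∧
                (zdGF3 𝔸 L β len (torusIdx (d := d) (le_trans one_le_two hL) t)).C139 B₁ (α₀ + (11 * (d : ℝ) ^ 2 * α₀ + α₁)) U₀
                  ((zdGF3 𝔸 L β len (torusIdx (d := d) (le_trans one_le_two hL) t)).act P u)) ∧
              ∀ u' : (zdGF3 𝔸 L β len (torusIdx (d := d) (le_trans one_le_two hL) t)).GT,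
                (zdGF3 𝔸 L β len (torusIdx (d := d) (le_trans one_le_two hL) t)).Restricted U₀ u' →
                (zdGF3 𝔸 L β len (torusIdx (d := d) (le_trans one_le_two hL) t)).C136 B₁ B₂ (α₀ + (11 * (d : ℝ) ^ 2 * α₀ + α₁)) U₀
                  ((zdGF3 𝔸 L β len (torusIdx (d := d) (le_trans one_le_two hL) t)).act P u') →
                (zdGF3 𝔸 L β len (torusIdx (d := d) (le_trans one_le_two hL) t)).C137 α₁ U₀
                  ((zdGF3 𝔸 L β len (torusIdx (d := d) (le_trans one_le_two hL) t)).act P u') →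
                (zdGF3 𝔸 L β len (torusIdx (d := d) (le_trans one_le_two hL) t)).Landau U₀
                  ((zdGF3 𝔸 L β len (torusIdx (d := d) (le_trans one_le_two hL) t)).act P u') →
                (zdGF3 𝔸 L β len (torusIdx (d := d) (le_trans one_le_two hL) t)).C139 B₁ (α₀ + (11 * (d : ℝ) ^ 2 * α₀ + α₁)) U₀
                  ((zdGF3 𝔸 L β len (torusIdx (d := d) (le_trans one_le_two hL) t)).act P u') →
                  u' = u := by
  obtain ⟨B₁, B₂, c₁, hB₁, hB₂, hc₁, H⟩ :=
    thm2_of135_zd3_map_b9allE (𝔸 := 𝔸) (β := β) (len := len) hd2 hL hB₀ hB₀' hB₀β hB hcu hcF₀ hcF hcu' hcB9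
      (torusIdx (d := d) (le_trans one_le_two hL)) (fun t => rfl) SHFP₀ SHFP SP5u SB9all
  refine ⟨B₁, B₂, c₁, hB₁, hB₂, hc₁, fun t α₀ α₁ hα₀ hα₁ hs U₀ P hInA hReg hInAAx havg => ?_⟩
  exact H t (torusIdx_geom (le_trans one_le_two hL) t) α₀ α₁ hα₀ hα₁ hs U₀ P hInA hReg hInAAx havg

end Thm2

#print axioms torusIdx
#print axioms thm2_torus_of_socketsE

end Literature.MathematicalPhysics.QuantumFieldTheory.Balaban1983to89.B8Thm2TorusMember

end
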